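import Literature.NumberTheory.EllipticCurves.BhargavaShankarConeFamilies
import Literature.NumberTheory.EllipticCurves.BhargavaShankarAveragingRegion
import Mathlib.MeasureTheory.Integral.Pi
import HarnessLib

/-!
# Injectivity of `Ψ` on the parameter box and the volume of `G₀⁻¹ · (cone piece)`

Topic `Literature/NumberTheory/EllipticCurves`; combines `BhargavaShankarJacobianCV.lean` (the
change of variables `volume_image_psi`), `BhargavaShankarConeFamilies.lean` (the cone pieces and
`∂(I,J)/∂(m,τ) = m⁴ ι(τ)`) and `BhargavaShankarAveragingRegion.lean` (`G₀`, rigidity, `μ(G₀)`).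
Everything here is PROVED (no named facts).

For a cone piece `{m · c(τ) : 0 < m < 1, τ ∈ T}` the region `G₀⁻¹ · (piece) ⊂ V_ℝ ≅ ℝ⁵` is the
image `Ψ(box)` of the parameter box `box = {|x| < δ₀} × {|y−1| < δ₀} × [−δ₀, δ₀) × (0,1) × T`
(`paramBox`). We prove:

* `injOn_psi_cone`: `Ψ` is injective on the box (equal images ⇒ equal invariants ⇒ equal
  `(m, τ)` ⇒ `h h'⁻¹ ∈ Stab` near `1` ⇒ `h = h'` by rigidity ⇒ equal Iwasawa coordinates);
* `volume_image_psi_cone`: **`vol(Ψ(box)) = (1/27) · μ(G₀) · (1/5) · ∫_T |ι|`**, by the change of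
  variables and Fubini on the box (`integral_fintype_prod_eq_prod`), with
  `μ(G₀) = boxHaar = 2δ₀ (1/(1−δ₀) − 1/(1+δ₀)) 2δ₀` (`boxHaar_eq`);
* the five pieces: `8/5` (type `0`, `τ ∈ (−2,2)`), `8/5, 12/5, 12/5` (type `1`, pieces `B, C, D`),
  `8/5` (type `2+`, via `∫ ι₂ = 2(j(2) − j(−2)) = 8`) — times `(1/27) μ(G₀)`
  (`volume_image_psi_cone0/1B/1C/1D/2`). With `μ(𝓕) = π²/3` and `|Stab| = 2nᵢ` this gives
  Bhargava–Shankar's main terms `(4/135, 32/135, 8/135) ζ(2) X^{5/6}` of Theorem 2.1.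

## References

* M. Bhargava, A. Shankar, Ann. of Math. (2) 181 (2015) 191–242, §2.3 and Props. 2.7–2.8
  (arXiv:1006.1002v2 numbering). [cite: BhargavaShankarAnnals2015, §2.3 and Props. 2.7–2.8 (arXiv:1006.1002v2 numbering)]
-/

noncomputable section

open Real MeasureTheory Matrix Complex Set
open scoped MatrixGroups UpperHalfPlane

namespace Literature.NumberTheory.EllipticCurves

namespace BinaryQuartic

open Literature.MeasureTheory.Group

attribute [local instance] Literature.MeasureTheory.Group.fact_two_pi_pos

/-! ## The parameter box -/

/-- The sides of the parameter box: `x ∈ (−δ₀, δ₀)`, `y ∈ (1−δ₀, 1+δ₀)`, `θ ∈ [−δ₀, δ₀)`,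
`m ∈ (0, 1)`, `τ ∈ T`. [folklore] -/
def boxSides (T : Set ℝ) : Fin 5 → Set ℝ :=
  ![Ioo (-δ₀) δ₀, Ioo (1 - δ₀) (1 + δ₀), Ico (-δ₀) δ₀, Ioo 0 1, T]

/-- The parameter box `(G₀-coordinates) × (0,1) × T ⊂ ℝ⁵`. [folklore] -/
def paramBox (T : Set ℝ) : Set (Fin 5 → ℝ) := Set.univ.pi (boxSides T)

/-- Side `0`. [folklore] -/
@[simp] theorem boxSides_zero (T : Set ℝ) : boxSides T 0 = Ioo (-δ₀) δ₀ := rfl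
/-- Side `1`. [folklore] -/
@[simp] theorem boxSides_one (T : Set ℝ) : boxSides T 1 = Ioo (1 - δ₀) (1 + δ₀) := rfl
/-- Side `2`. [folklore] -/
@[simp] theorem boxSides_two (T : Set ℝ) : boxSides T 2 = Ico (-δ₀) δ₀ := rfl
/-- Side `3`. [folklore] -/
@[simp] theorem boxSides_three (T : Set ℝ) : boxSides T 3 = Ioo 0 1 := rfl
/-- Side `4`. [folklore] -/
@[simp] theorem boxSides_four (T : Set ℝ) : boxSides T 4 = T := rfl

/-- Membership in the parameter box, coordinatewise. [folklore] -/
theorem mem_paramBox_iff {T : Set ℝ} {p : Fin 5 → ℝ} :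
    p ∈ paramBox T ↔ p 0 ∈ Ioo (-δ₀) δ₀ ∧ p 1 ∈ Ioo (1 - δ₀) (1 + δ₀) ∧ p 2 ∈ Ico (-δ₀) δ₀ ∧
      p 3 ∈ Ioo (0 : ℝ) 1 ∧ p 4 ∈ T := by
  simp only [paramBox, mem_univ_pi, Fin.forall_fin_succ, Fin.isValue, boxSides_zero, IsEmpty.forall_iff,
    and_true]
  exact Iff.rfl

/-- The box is measurable. [folklore] -/
theorem measurableSet_paramBox {T : Set ℝ} (hT : MeasurableSet T) : MeasurableSet (paramBox T) := by
  refine MeasurableSet.univ_pi fun i => ?_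
  fin_cases i
  · exact measurableSet_Ioo
  · exact measurableSet_Ioo
  · exact measurableSet_Ico
  · exact measurableSet_Ioo
  · exact hT

/-- On the box `y > 0`. [folklore] -/
theorem paramBox_subset (T : Set ℝ) : paramBox T ⊆ {p | 0 < p 1} := by
  intro p hp
  have := (mem_paramBox_iff.1 hp).2.1.1
  simp only [mem_setOf_eq]; norm_num [δ₀] at this; linarith

/-! ## Injectivity of `Ψ` on the box -/

/-- `G(x,y,θ) = (ñ(x) a(√y) k(θ))⁻¹`. [folklore] -/
theorem iwasawaG_eq_inv (x : ℝ) {y : ℝ} (hy : 0 < y) (θ : ℝ) : iwasawaG x y θ = (iwasawaGinv x y θ)⁻¹ :=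
  (Matrix.inv_eq_right_inv (iwasawaGinv_mul_iwasawaG (x := x) hy θ)).symm

/-- The `G₀`-element attached to a box point. [folklore] -/
theorem iwasawaGinv_mem_G0 {T : Set ℝ} {p : Fin 5 → ℝ} (hp : p ∈ paramBox T) :
    iwasawaGinv (p 0) (p 1) (p 2) ∈ G0 := by
  obtain ⟨h0, h1, h2, -, -⟩ := mem_paramBox_iff.1 hp
  exact mem_G0_iff.2 ⟨p 0, p 1, p 2, abs_lt.2 ⟨h0.1, h0.2⟩, abs_lt.2 ⟨by linarith [h1.1], by linarith [h1.2]⟩, h2, rfl⟩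

/-- Real numbers in `[−δ₀, δ₀)` with the same class mod `2π` are equal. [folklore] -/
theorem eq_of_coe_eq {θ θ' : ℝ} (hθ : θ ∈ Ico (-δ₀) δ₀) (hθ' : θ' ∈ Ico (-δ₀) δ₀)
    (h : (θ : AddCircle (2 * π)) = θ') : θ = θ' := by
  have hπ := Real.pi_gt_three
  have h1 : θ ∈ Ico (-δ₀) (-δ₀ + 2 * π) := ⟨hθ.1, by have := hθ.2; norm_num [δ₀] at this ⊢; linarith⟩
  have h2 : θ' ∈ Ico (-δ₀) (-δ₀ + 2 * π) := ⟨hθ'.1, by have := hθ'.2; norm_num [δ₀] at this ⊢; linarith⟩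
  exact (AddCircle.coe_eq_coe_iff_of_mem_Ico h1 h2).1 h

/-- **`Ψ` is injective on the box** for a cone over a curve of forms with `Δ ≠ 0` whose cone
points are determined by their invariants: equal images have equal invariants, hence equal
`(m, τ)`; then `h h'⁻¹` stabilises the form and lies near `1`, so `h = h'` by rigidity, and the
Iwasawa coordinates are unique. [folklore] -/
theorem injOn_psi_cone (C : SmoothCurve) {T : Set ℝ} (hΔ : ∀ τ ∈ T, (C.c τ).disc ≠ 0)
    (huniq : ∀ m m' τ τ' : ℝ, 0 < m → 0 < m' → τ ∈ T → τ' ∈ T →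
      (m • C.c τ).I = (m' • C.c τ').I → (m • C.c τ).J = (m' • C.c τ').J → m = m' ∧ τ = τ') :
    Set.InjOn (psi C.cone) (paramBox T) := by
  intro p hp p' hp' heq
  obtain ⟨-, h1, h2, h3, h4⟩ := mem_paramBox_iff.1 hp
  obtain ⟨-, h1', h2', h3', h4'⟩ := mem_paramBox_iff.1 hp'
  have hy : 0 < p 1 := paramBox_subset T hp
  have hy' : 0 < p' 1 := paramBox_subset T hp'
  -- the forms are equal
  have hforms : (p 3 • C.c (p 4)).subst (iwasawaG (p 0) (p 1) (p 2)) =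
      (p' 3 • C.c (p' 4)).subst (iwasawaG (p' 0) (p' 1) (p' 2)) := coeffs_injective heq
  -- invariants
  have hdet : (iwasawaG (p 0) (p 1) (p 2)).det = 1 := det_iwasawaG hy _
  have hdet' : (iwasawaG (p' 0) (p' 1) (p' 2)).det = 1 := det_iwasawaG hy' _
  have hI : (p 3 • C.c (p 4)).I = (p' 3 • C.c (p' 4)).I := by
    have := congrArg BinaryQuartic.I hforms
    rwa [I_subst_of_det (Or.inl hdet), I_subst_of_det (Or.inl hdet')] at this
  have hJ : (p 3 • C.c (p 4)).J = (p' 3 • C.c (p' 4)).J := by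
    have := congrArg BinaryQuartic.J hforms
    rwa [J_subst_of_det (Or.inl hdet), J_subst_of_det (Or.inl hdet')] at this
  obtain ⟨hm, hτ⟩ := huniq _ _ _ _ h3.1 h3'.1 h4 h4' hI hJ
  -- the stabiliser element `h G'`
  set P : BinaryQuartic ℝ := p 3 • C.c (p 4) with hP
  have hΔP : P.disc ≠ 0 := by
    rw [hP, disc_smul_real]; exact mul_ne_zero (pow_ne_zero 6 h3.1.ne') (hΔ _ h4)
  set h : Matrix (Fin 2) (Fin 2) ℝ := iwasawaGinv (p 0) (p 1) (p 2) with hh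
  set h' : Matrix (Fin 2) (Fin 2) ℝ := iwasawaGinv (p' 0) (p' 1) (p' 2) with hh'
  have hhG0 : h ∈ G0 := iwasawaGinv_mem_G0 hp
  have hh'G0 : h' ∈ G0 := iwasawaGinv_mem_G0 hp'
  have hG' : iwasawaG (p' 0) (p' 1) (p' 2) = h'⁻¹ := iwasawaG_eq_inv _ hy' _
  rw [← hm, ← hτ, ← hP] at hforms
  have hstab : h * h'⁻¹ ∈ substStabilizer P := by
    show P.subst (h * h'⁻¹) = P
    rw [subst_mul, ← hG', ← hforms, ← subst_mul, hh, iwasawaGinv_mul_iwasawaG hy, subst_one]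
  obtain ⟨hd0, hd1⟩ := diag_pos_of_mem_G0 hhG0 hh'G0
  rw [← inv_eq_adjugate_of_mem_G0 hh'G0] at hd0 hd1
  have hσ1 : h * h'⁻¹ = 1 := by
    rcases scalar_or_trace_zero_of_mem_substStabilizer hΔP hstab with (e | e) | e
    · exact e
    · exfalso; rw [e] at hd0; simp at hd0; linarith
    · exfalso; linarith
  have hhh : h = h' := by
    have e1 : h * h'⁻¹ * h' = h' := by rw [hσ1, Matrix.one_mul]
    rwa [Matrix.mul_assoc, ← hG', hh', iwasawaG_mul_iwasawaGinv hy', Matrix.mul_one] at e1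
  -- coordinates
  have hcoord : ((⟨⟨p 0, p 1⟩, hy⟩ : ℍ), ((p 2 : ℝ) : AddCircle (2 * π))) =
      ((⟨⟨p' 0, p' 1⟩, hy'⟩ : ℍ), ((p' 2 : ℝ) : AddCircle (2 * π))) := by
    apply iwasawa_injective
    rw [iwasawa_eq_iwasawaGinv, iwasawa_eq_iwasawaGinv, ← hh, ← hh', hhh]
  obtain ⟨hz, hθ⟩ := Prod.mk.inj hcoord
  have h0 : p 0 = p' 0 := by
    have := congrArg (fun z : ℍ => (z : ℂ).re) hz; simpa using this
  have h1e : p 1 = p' 1 := by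
    have := congrArg (fun z : ℍ => (z : ℂ).im) hz; simpa using this
  have h2e : p 2 = p' 2 := eq_of_coe_eq h2 h2' hθ
  funext i
  fin_cases i
  · exact h0
  · exact h1e
  · exact h2e
  · exact hm
  · exact hτ

/-! ## One-dimensional integrals -/

/-- `∫_{1−δ₀}^{1+δ₀} y⁻² dy = 1/(1−δ₀) − 1/(1+δ₀)`. [folklore] -/
theorem integral_inv_sq_Ioo :
    ∫ y in Ioo (1 - δ₀) (1 + δ₀), (y⁻¹) ^ 2 = 1 / (1 - δ₀) - 1 / (1 + δ₀) := by
  have hδ : (0 : ℝ) < 1 - δ₀ := by norm_num [δ₀]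
  have hle : 1 - δ₀ ≤ 1 + δ₀ := by norm_num [δ₀]
  rw [← integral_Icc_eq_integral_Ioo, integral_Icc_eq_integral_Ioc, ← intervalIntegral.integral_of_le hle,
    intervalIntegral.integral_eq_sub_of_hasDerivAt (f := fun y : ℝ => -y⁻¹)]
  · simp only [one_div]; ring
  · intro y hy
    rw [Set.uIcc_of_le hle] at hy
    have hy0 : y ≠ 0 := by linarith [hy.1]
    refine ((hasDerivAt_inv hy0).neg).congr_deriv ?_
    field_simp
  · have hcont : ContinuousOn (fun y : ℝ => (y⁻¹) ^ 2) (Set.uIcc (1 - δ₀) (1 + δ₀)) := by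
      rw [Set.uIcc_of_le hle]
      refine ContinuousOn.pow (continuousOn_inv₀.mono ?_) 2
      intro y hy; simp only [mem_compl_iff, mem_singleton_iff]; linarith [hy.1]
    exact hcont.intervalIntegrable

/-- `∫₀¹ m⁴ dm = 1/5`. [folklore] -/
theorem integral_pow_four_Ioo : ∫ m in Ioo (0 : ℝ) 1, m ^ 4 = 1 / 5 := by
  rw [← integral_Icc_eq_integral_Ioo, integral_Icc_eq_integral_Ioc, ← intervalIntegral.integral_of_le zero_le_one,
    integral_pow]
  norm_num

/-- The `(x, y, θ)`-factor `2δ₀ · (1/(1−δ₀) − 1/(1+δ₀)) · 2δ₀ = μ(G₀)` of the box integral.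
[folklore] -/
def boxHaar : ℝ := 2 * δ₀ * (1 / (1 - δ₀) - 1 / (1 + δ₀)) * (2 * δ₀)

/-- `boxHaar = μ(G₀)`. [folklore] -/
theorem boxHaar_eq [MeasurableSpace (Matrix (Fin 2) (Fin 2) ℝ)] [BorelSpace (Matrix (Fin 2) (Fin 2) ℝ)] :
    boxHaar = (haarSL2pm G0).toReal := by
  rw [haarSL2pm_G0_toReal, boxHaar]

/-- `boxHaar > 0`. [folklore] -/
theorem boxHaar_pos : 0 < boxHaar := by norm_num [boxHaar, δ₀]

/-! ## The volume of `Ψ(box)` -/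

/-- The factors of the box integrand. [folklore] -/
def boxFactor (C : SmoothCurve) : Fin 5 → ℝ → ℝ :=
  ![fun _ => 1, fun y => (y⁻¹) ^ 2, fun _ => 1, fun m => m ^ 4, fun τ => |C.iota τ| / 27]

/-- The Jacobian integrand of a cone family factors over the coordinates. [folklore] -/
theorem abs_jac_cone_eq_prod (C : SmoothCurve) (p : Fin 5 → ℝ) :
    |1 / 27 * ((p 1)⁻¹) ^ 2 * jacIJ C.cone (p 3) (p 4)| = ∏ i, boxFactor C i (p i) := by
  rw [C.jacIJ_cone, Fin.prod_univ_five]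
  simp only [boxFactor, Matrix.cons_val_zero, Matrix.cons_val_one, Matrix.cons_val, Fin.isValue]
  rw [abs_mul, abs_mul, abs_mul, abs_of_nonneg (by norm_num : (0:ℝ) ≤ 1 / 27), abs_of_nonneg (sq_nonneg _),
    abs_of_nonneg (by positivity : (0:ℝ) ≤ p 3 ^ 4)]
  ring

/-- Integrability of the factors on the sides. [folklore] -/
theorem integrable_boxFactor (C : SmoothCurve) {T : Set ℝ}
    (hι : IntegrableOn (fun τ => |C.iota τ|) T) (i : Fin 5) :
    Integrable (boxFactor C i) (volume.restrict (boxSides T i)) := by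
  fin_cases i
  · simp only [boxFactor, boxSides, Fin.zero_eta, Matrix.cons_val_zero]
    exact integrableOn_const (by rw [Real.volume_Ioo]; exact ENNReal.ofReal_ne_top)
  · simp only [boxFactor, boxSides, Fin.mk_one, Matrix.cons_val_one, Matrix.cons_val_zero]
    have hcont : ContinuousOn (fun y : ℝ => (y⁻¹) ^ 2) (Icc (1 - δ₀) (1 + δ₀)) := by
      refine ContinuousOn.pow (continuousOn_inv₀.mono ?_) 2
      intro y hy; simp only [mem_compl_iff, mem_singleton_iff]
      have := hy.1; norm_num [δ₀] at this; linarith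
    exact (hcont.integrableOn_Icc).mono_set Ioo_subset_Icc_self
  · simp only [boxFactor, boxSides, Fin.reduceFinMk, Matrix.cons_val]
    exact integrableOn_const (by rw [Real.volume_Ico]; exact ENNReal.ofReal_ne_top)
  · simp only [boxFactor, boxSides, Fin.reduceFinMk, Matrix.cons_val]
    exact ((continuous_pow 4).continuousOn.integrableOn_Icc (a := (0:ℝ)) (b := 1)).mono_set Ioo_subset_Icc_self
  · simp only [boxFactor, boxSides, Fin.reduceFinMk, Matrix.cons_val]
    exact hι.div_const 27

/-- **The volume of `Ψ(box)`** (Bhargava–Shankar's `Vol(R_X(v))`-type computation, here for the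
region `G₀⁻¹ · (cone piece)`): for a cone over a curve of forms with `Δ ≠ 0` determined by their
invariants,
`vol(Ψ((G₀-box) × (0,1) × T)) = (1/27) · μ(G₀) · (1/5) · ∫_T |ι(τ)| dτ`. [cite: BhargavaShankarAnnals2015, Props. 2.7–2.8 and §2.3 (volumes of the multisets G₀L, R_X(v); arXiv:1006.1002v2 numbering)] -/
theorem volume_image_psi_cone (C : SmoothCurve) {T : Set ℝ} (hT : MeasurableSet T)
    (hΔ : ∀ τ ∈ T, (C.c τ).disc ≠ 0)
    (huniq : ∀ m m' τ τ' : ℝ, 0 < m → 0 < m' → τ ∈ T → τ' ∈ T →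
      (m • C.c τ).I = (m' • C.c τ').I → (m • C.c τ).J = (m' • C.c τ').J → m = m' ∧ τ = τ')
    (hι : IntegrableOn (fun τ => |C.iota τ|) T) :
    volume (psi C.cone '' paramBox T) =
      ENNReal.ofReal (1 / 27 * boxHaar * (1 / 5) * ∫ τ in T, |C.iota τ|) := by
  rw [volume_image_psi (measurableSet_paramBox hT) (paramBox_subset T) (injOn_psi_cone C hΔ huniq)]
  have hF : (fun p : Fin 5 → ℝ => ENNReal.ofReal |1 / 27 * ((p 1)⁻¹) ^ 2 * jacIJ C.cone (p 3) (p 4)|) =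
      fun p => ENNReal.ofReal (∏ i, boxFactor C i (p i)) := by
    funext p; rw [abs_jac_cone_eq_prod]
  rw [hF]
  have hpi : (volume : Measure (Fin 5 → ℝ)).restrict (paramBox T) =
      Measure.pi fun i => volume.restrict (boxSides T i) := by
    rw [paramBox, volume_pi, Measure.restrict_pi_pi]
  have hint : Integrable (fun p : Fin 5 → ℝ => ∏ i, boxFactor C i (p i))
      (Measure.pi fun i => volume.restrict (boxSides T i)) :=
    Integrable.fintype_prod (integrable_boxFactor C hι)
  have hnn : 0 ≤ᵐ[Measure.pi fun i => volume.restrict (boxSides T i)] fun p : Fin 5 → ℝ => ∏ i, boxFactor C i (p i) := by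
    refine Filter.Eventually.of_forall fun p => ?_
    simp only [Pi.zero_apply]
    rw [← abs_jac_cone_eq_prod]; exact abs_nonneg _
  rw [hpi, ← ofReal_integral_eq_lintegral_ofReal hint hnn, integral_fintype_prod_eq_prod]
  congr 1
  rw [Fin.prod_univ_five]
  simp only [boxFactor, boxSides, Matrix.cons_val_zero, Matrix.cons_val_one, Matrix.cons_val, Fin.isValue]
  rw [setIntegral_const, setIntegral_const, Measure.real, Measure.real, Real.volume_Ioo, Real.volume_Ico,
    ENNReal.toReal_ofReal (by norm_num [δ₀]), integral_inv_sq_Ioo, integral_pow_four_Ioo, integral_div]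
  simp only [smul_eq_mul, mul_one, boxHaar]
  ring

/-! ## The five pieces: `Area = 8/5, (8 + 12 + 12)/5, 8/5` -/

/-- Type `0`: `vol(Ψ₀(box × (0,1) × (−2,2))) = (1/27) μ(G₀) · 8/5`. [cite: BhargavaShankarAnnals2015, §2.3 and Props. 2.7–2.8 (arXiv:1006.1002v2 numbering)] -/
theorem volume_image_psi_cone0 :
    volume (psi curve0.cone '' paramBox (Ioo (-2) 2)) = ENNReal.ofReal (1 / 27 * boxHaar * (8 / 5)) := by
  rw [volume_image_psi_cone curve0 measurableSet_Ioo]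
  · congr 1
    simp only [iota_curve0]
    rw [setIntegral_const, Measure.real, Real.volume_Ioo, ENNReal.toReal_ofReal (by norm_num)]
    ring
  · intro τ hτ
    rw [disc_curve0]
    have : τ ^ 2 < 4 := by nlinarith [hτ.1, hτ.2]
    intro h; linarith
  · intro m m' τ τ' hm hm' _ _ hI hJ
    exact cone0_params_unique hm hm' hI hJ
  · simp only [iota_curve0]
    exact integrableOn_const (by rw [Real.volume_Ioo]; exact ENNReal.ofReal_ne_top)

/-- Type `1`, piece `B`: `vol = (1/27) μ(G₀) · 8/5` (`τ ∈ [−2, 2]`). [cite: BhargavaShankarAnnals2015, §2.3 and Props. 2.7–2.8 (arXiv:1006.1002v2 numbering)] -/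
theorem volume_image_psi_cone1B :
    volume (psi curve1B.cone '' paramBox (Icc (-2) 2)) = ENNReal.ofReal (1 / 27 * boxHaar * (8 / 5)) := by
  rw [volume_image_psi_cone curve1B measurableSet_Icc]
  · congr 1
    simp only [iota_curve1B, abs_neg]
    rw [setIntegral_const, Measure.real, Real.volume_Icc, ENNReal.toReal_ofReal (by norm_num)]
    ring
  · intro τ _
    rw [disc_curve1B]
    have : 0 ≤ τ ^ 2 := sq_nonneg τ
    intro h; linarith
  · intro m m' τ τ' hm hm' _ _ hI hJ
    exact cone1B_params_unique hm hm' hI hJ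
  · simp only [iota_curve1B]
    exact integrableOn_const (by rw [Real.volume_Icc]; exact ENNReal.ofReal_ne_top)

/-- Type `1`, piece `C`: `vol = (1/27) μ(G₀) · 12/5` (`τ ∈ (−1, 1)`). [cite: BhargavaShankarAnnals2015, §2.3 and Props. 2.7–2.8 (arXiv:1006.1002v2 numbering)] -/
theorem volume_image_psi_cone1C :
    volume (psi curve1C.cone '' paramBox (Ioo (-1) 1)) = ENNReal.ofReal (1 / 27 * boxHaar * (12 / 5)) := by
  rw [volume_image_psi_cone curve1C measurableSet_Ioo]
  · congr 1
    simp only [iota_curve1C, abs_neg]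
    rw [setIntegral_const, Measure.real, Real.volume_Ioo, ENNReal.toReal_ofReal (by norm_num)]
    ring
  · intro τ hτ
    rw [disc_curve1C]
    have : τ ^ 3 < 1 := by
      calc τ ^ 3 < 1 ^ 3 := by
            rcases le_or_gt 0 τ with h0 | h0
            · exact pow_lt_pow_left₀ hτ.2 h0 (by norm_num)
            · have : τ ^ 3 < 0 := by
                have : τ ^ 3 = τ * τ ^ 2 := by ring
                rw [this]; exact mul_neg_of_neg_of_pos h0 (lt_of_le_of_ne (sq_nonneg τ) (Ne.symm (pow_ne_zero 2 h0.ne)))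
              linarith
        _ = 1 := by norm_num
    intro h; linarith
  · intro m m' τ τ' hm hm' _ _ hI hJ
    exact cone1C_params_unique hm hm' hI hJ
  · simp only [iota_curve1C]
    exact integrableOn_const (by rw [Real.volume_Ioo]; exact ENNReal.ofReal_ne_top)

/-- Type `1`, piece `D`: `vol = (1/27) μ(G₀) · 12/5` (`τ ∈ (−1, 1)`). [cite: BhargavaShankarAnnals2015, §2.3 and Props. 2.7–2.8 (arXiv:1006.1002v2 numbering)] -/
theorem volume_image_psi_cone1D :
    volume (psi curve1D.cone '' paramBox (Ioo (-1) 1)) = ENNReal.ofReal (1 / 27 * boxHaar * (12 / 5)) := by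
  rw [volume_image_psi_cone curve1D measurableSet_Ioo]
  · congr 1
    simp only [iota_curve1D]
    rw [setIntegral_const, Measure.real, Real.volume_Ioo, ENNReal.toReal_ofReal (by norm_num)]
    ring
  · intro τ hτ
    rw [disc_curve1D]
    have : τ ^ 3 < 1 := by
      calc τ ^ 3 < 1 ^ 3 := by
            rcases le_or_gt 0 τ with h0 | h0
            · exact pow_lt_pow_left₀ hτ.2 h0 (by norm_num)
            · have : τ ^ 3 < 0 := by
                have : τ ^ 3 = τ * τ ^ 2 := by ring
                rw [this]; exact mul_neg_of_neg_of_pos h0 (lt_of_le_of_ne (sq_nonneg τ) (Ne.symm (pow_ne_zero 2 h0.ne)))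
              linarith
        _ = 1 := by norm_num
    intro h; linarith
  · intro m m' τ τ' hm hm' _ _ hI hJ
    exact cone1D_params_unique hm hm' hI hJ
  · simp only [iota_curve1D]
    exact integrableOn_const (by rw [Real.volume_Ioo]; exact ENNReal.ofReal_ne_top)

/-- `∫_{−2}^{2} ι₂(s) ds = 2 (j(2) − j(−2)) = 8` (`ι₂ = 2 j'`). [folklore] -/
theorem integral_iota_curve2 : ∫ s in Ioo (-2 : ℝ) 2, |curve2.iota s| = 8 := by
  have habs : ∀ s ∈ Ioo (-2 : ℝ) 2, |curve2.iota s| = 2 * (216 * rad2 s ^ 5 * (4 - s ^ 2)) := by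
    intro s hs
    rw [iota_curve2, abs_of_nonneg]
    · ring
    · have := rad2_pos s
      have h4 : 0 ≤ 4 - s ^ 2 := by nlinarith [hs.1, hs.2]
      positivity
  rw [setIntegral_congr_fun measurableSet_Ioo habs, ← integral_Icc_eq_integral_Ioo, integral_Icc_eq_integral_Ioc,
    ← intervalIntegral.integral_of_le (by norm_num), intervalIntegral.integral_const_mul,
    intervalIntegral.integral_eq_sub_of_hasDerivAt (f := jfun) (fun s _ => hasDerivAt_jfun s), jfun_two,
    jfun_neg_two]
  · norm_num
  · exact ((continuous_const.mul ((contDiff_rad2.continuous.pow 5))).mul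
      (continuous_const.sub (continuous_pow 2))).intervalIntegrable _ _

/-- Type `2+`: `vol = (1/27) μ(G₀) · 8/5` (`s ∈ (−2, 2)`). [cite: BhargavaShankarAnnals2015, §2.3 and Props. 2.7–2.8 (arXiv:1006.1002v2 numbering)] -/
theorem volume_image_psi_cone2 :
    volume (psi curve2.cone '' paramBox (Ioo (-2) 2)) = ENNReal.ofReal (1 / 27 * boxHaar * (8 / 5)) := by
  have hint : IntegrableOn (fun τ => |curve2.iota τ|) (Ioo (-2 : ℝ) 2) := by
    have hc : Continuous fun s => |curve2.iota s| := by
      have : Continuous fun s => 432 * rad2 s ^ 5 * (4 - s ^ 2) :=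
        (continuous_const.mul (contDiff_rad2.continuous.pow 5)).mul (continuous_const.sub (continuous_pow 2))
      simp only [iota_curve2]
      exact this.abs
    exact (hc.continuousOn.integrableOn_Icc (a := (-2:ℝ)) (b := 2)).mono_set Ioo_subset_Icc_self
  rw [volume_image_psi_cone curve2 measurableSet_Ioo]
  · rw [integral_iota_curve2]; congr 1; ring
  · intro τ hτ; exact (disc_curve2_pos hτ).ne'
  · intro m m' τ τ' hm hm' hτ hτ' hI hJ
    exact cone2_params_unique hm hm' ⟨hτ.1.le, hτ.2.le⟩ ⟨hτ'.1.le, hτ'.2.le⟩ hI hJ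
  · exact hint

end BinaryQuartic

end Literature.NumberTheory.EllipticCurves

end
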